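import Summits.CriticalPhenomena.PercolationContinuityZ3.Theses.PercNearOneGluing
import Summits.CriticalPhenomena.PercolationContinuityZ3.Theorems.PercNearOneGluingAdditiveGluingKnLemma4Pair
import HarnessLib

/-!
# Crux `PercNearOneGluing.AdditiveGluing` (stmt-CriticalPhenomena-4576): the conditioned form CAG ("Kozma–Nitzan Lemma 4 for sets")
# implies the crux, and holds for two relays

Support file (`--supports stmt-CriticalPhenomena-4576`, lead prim-png-lead-4576).  No definitions, no named facts, no sorries.

**CAG** (conditioned additive gluing; the gain form of the crux).  For a relay set `A`, target `b`, observer `o` and a minimiser `a₀`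
of `τ = μ(· ↔ b)` on `A`:
  `μ(o↔A, o↮b, A↔b) ≤ μ(A↔b) − τ(a₀)`,
i.e. `Gain_A(o) ≤ Gain_A(a₀)` with `Gain_A(x) = μ_{G/A}(x↔b) − μ_G(x↔b)`: gluing the relay set helps no outside vertex more than it helps
its least reliable member.  It is the crux inequality intersected with the event `{A ↔ b}`; for `|A| = 2` it is Kozma–Nitzan's Lemma 4 /
eq. (8) (landed `knLemma4_pair`); Kozma–Nitzan's Question 7 form implies it and it implies the crux (both by two-line event algebra).
It is the gluing instance of the gain max principle of the lead's memo LeadMath-prim4 (evidence on the item).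

* `additiveGluing_of_cag` — CAG (for every instance) ⟹ `AdditiveGluing`.
* `cag_pair` — CAG for a two-element relay set (from `knLemma4_pair`).
[cite: KozmaNitzan2024, Lemma 4 (p. 9), eq. (8)–(9), Question 7 (p. 36)]
-/

namespace Summit.CriticalPhenomena.PercolationContinuityZ3.Theorems

open MeasureTheory Set Literature.Probability.LatticeModels Literature.Probability.Percolation

noncomputable section
open Classical

variable {n : ℕ}

/-- **CAG implies the crux.**  If for every weighted graph, relay set `A`, observer `o`, target `b` and minimiser `a₀ ∈ A` of
`μ(·↔b)` one has `μ(o↔A ∩ o↮b ∩ A↔b) ≤ μ(A↔b) − μ(a₀↔b)`, then `AdditiveGluing` holds: split `o↔A ∖ o↔b` according to `A↔b`;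
the part with `A↮b` has probability at most `1 − μ(A↔b)`. [cite: KozmaNitzan2024, Lemma 4 (p. 9), Question 7 (p. 36)] -/
theorem additiveGluing_of_cag
    (hcag : ∀ (n : ℕ) (w : Sym2 (Fin n) → unitInterval) (A : Finset (Fin n)) (o b a₀ : Fin n),
      a₀ ∈ A → (∀ a ∈ A, (prodBernoulli w).real (openConn a₀ b) ≤ (prodBernoulli w).real (openConn a b)) →
      (prodBernoulli w).real ((⋃ a ∈ A, openConn o a) ∩ (openConn o b)ᶜ ∩ (⋃ a ∈ A, openConn a b)) ≤
        (prodBernoulli w).real (⋃ a ∈ A, openConn a b) - (prodBernoulli w).real (openConn a₀ b)) :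
    Summit.CriticalPhenomena.PercolationContinuityZ3.Theses.PercNearOneGluing.AdditiveGluing := by
  intro n w A o b t ht hrel
  have hm : ∀ s : Set (BondConfig (Fin n)), MeasurableSet s := fun _ => MeasurableSet.of_discrete
  set OA : Set (BondConfig (Fin n)) := ⋃ a ∈ A, openConn o a with hOA
  set Ob : Set (BondConfig (Fin n)) := openConn o b with hOb
  set AB : Set (BondConfig (Fin n)) := ⋃ a ∈ A, openConn a b with hAB
  by_cases hA : A = ∅
  · have h0 : (prodBernoulli w).real OA = 0 := by
      rw [hOA, hA]; simp
    have hnn : 0 ≤ (prodBernoulli w).real Ob := measureReal_nonneg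
    linarith
  obtain ⟨a₀, ha₀, hmin⟩ := Finset.exists_min_image A (fun a => (prodBernoulli w).real (openConn a b))
    (Finset.nonempty_of_ne_empty hA)
  have hc := hcag n w A o b a₀ ha₀ hmin
  -- `μ(OA) ≤ μ(OA ∩ Obᶜ) + μ(Ob)`
  have h1 : (prodBernoulli w).real OA ≤ (prodBernoulli w).real (OA ∩ Obᶜ) + (prodBernoulli w).real Ob := by
    have hsub : OA ⊆ (OA ∩ Obᶜ) ∪ Ob := by
      intro ω hω
      by_cases hb : ω ∈ Ob
      · exact Or.inr hb
      · exact Or.inl ⟨hω, hb⟩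
    exact (measureReal_mono hsub (measure_ne_top _ _)).trans (measureReal_union_le _ _)
  -- `μ(OA ∩ Obᶜ) = μ(OA ∩ Obᶜ ∩ AB) + μ((OA ∩ Obᶜ) \ AB)`
  have h2 := measureReal_inter_add_sdiff (μ := prodBernoulli w) (s := OA ∩ Obᶜ) (hm AB)
  -- `μ((OA ∩ Obᶜ) \ AB) ≤ μ(ABᶜ) = 1 − μ(AB)`
  have h3 : (prodBernoulli w).real ((OA ∩ Obᶜ) \ AB) ≤ (prodBernoulli w).real ABᶜ :=
    measureReal_mono (fun ω hω => hω.2) (measure_ne_top _ _)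
  have h4 : (prodBernoulli w).real ABᶜ = 1 - (prodBernoulli w).real AB := probReal_compl_eq_one_sub (hm _)
  have h5 := hrel a₀ ha₀
  linarith

/-- **CAG for two relays** is Kozma–Nitzan's Lemma 4 (pair pivotality, landed `knLemma4_pair`), here in the `Finset`/minimiser form
used by `additiveGluing_of_cag`. [cite: KozmaNitzan2024, Lemma 4 (p. 9), eq. (8)] -/
theorem cag_pair (w : Sym2 (Fin n) → unitInterval) (o b s₁ s₂ a₀ : Fin n) (ha₀ : a₀ ∈ ({s₁, s₂} : Finset (Fin n)))
    (hmin : ∀ a ∈ ({s₁, s₂} : Finset (Fin n)), (prodBernoulli w).real (openConn a₀ b) ≤ (prodBernoulli w).real (openConn a b)) :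
    (prodBernoulli w).real ((⋃ a ∈ ({s₁, s₂} : Finset (Fin n)), openConn o a) ∩ (openConn o b)ᶜ ∩
        (⋃ a ∈ ({s₁, s₂} : Finset (Fin n)), openConn a b)) ≤
      (prodBernoulli w).real (⋃ a ∈ ({s₁, s₂} : Finset (Fin n)), openConn a b) - (prodBernoulli w).real (openConn a₀ b) := by
  have hU1 : (⋃ a ∈ ({s₁, s₂} : Finset (Fin n)), (openConn o a : Set (BondConfig (Fin n)))) = openConn o s₁ ∪ openConn o s₂ := by
    ext ω; simp only [Set.mem_iUnion, exists_prop, Set.mem_union, Finset.mem_insert, Finset.mem_singleton]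
    constructor
    · rintro ⟨a, ha | ha, h⟩ <;> subst ha
      · exact Or.inl h
      · exact Or.inr h
    · rintro (h | h)
      · exact ⟨s₁, Or.inl rfl, h⟩
      · exact ⟨s₂, Or.inr rfl, h⟩
  have hU2 : (⋃ a ∈ ({s₁, s₂} : Finset (Fin n)), (openConn a b : Set (BondConfig (Fin n)))) = openConn s₁ b ∪ openConn s₂ b := by
    ext ω; simp only [Set.mem_iUnion, exists_prop, Set.mem_union, Finset.mem_insert, Finset.mem_singleton]
    constructor
    · rintro ⟨a, ha | ha, h⟩ <;> subst ha
      · exact Or.inl h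
      · exact Or.inr h
    · rintro (h | h)
      · exact ⟨s₁, Or.inl rfl, h⟩
      · exact ⟨s₂, Or.inr rfl, h⟩
  rw [hU1, hU2]
  have hk := knLemma4_pair w o s₁ s₂ b
  have heq : ((openConn o s₁ ∪ openConn o s₂) ∩ (openConn o b)ᶜ ∩ (openConn s₁ b ∪ openConn s₂ b) : Set (BondConfig (Fin n))) =
      (openConn o b)ᶜ ∩ (openConn o s₁ ∪ openConn o s₂) ∩ (openConn s₁ b ∪ openConn s₂ b) := by
    ext ω; simp only [Set.mem_inter_iff]; tauto
  rw [heq]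
  -- the minimum over the pair is attained at `a₀`
  have h1 := hmin s₁ (Finset.mem_insert_self _ _)
  have h2 := hmin s₂ (Finset.mem_insert_of_mem (Finset.mem_singleton_self _))
  have hmin' : (prodBernoulli w).real (openConn a₀ b) ≤
      min ((prodBernoulli w).real (openConn s₁ b)) ((prodBernoulli w).real (openConn s₂ b)) := le_min h1 h2
  have hmem : (prodBernoulli w).real (openConn a₀ b) = (prodBernoulli w).real (openConn s₁ b) ∨
      (prodBernoulli w).real (openConn a₀ b) = (prodBernoulli w).real (openConn s₂ b) := by
    rcases Finset.mem_insert.1 ha₀ with h | h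
    · exact Or.inl (by rw [h])
    · rw [Finset.mem_singleton] at h; exact Or.inr (by rw [h])
  have hge : min ((prodBernoulli w).real (openConn s₁ b)) ((prodBernoulli w).real (openConn s₂ b)) ≤
      (prodBernoulli w).real (openConn a₀ b) := by
    rcases hmem with h | h
    · rw [h]; exact min_le_left _ _
    · rw [h]; exact min_le_right _ _
  linarith

end

end Summit.CriticalPhenomena.PercolationContinuityZ3.Theorems
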